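import Summits.ResolutionOfSingularities.ResolutionOfSingularities.Theorems.PurelyInseparableDim4JointWaitingNodeDefsTwo
import HarnessLib

/-!
# Purely inseparable four-folds: NAMES for ATLAS MEMBERS — linear escaping children with fibrewise descendants (brick S3 (c) v4,
# tranche 1, definitions; cell `res-dim4-pi`)

[OURS · counted 0] (D-0157 DOOR 2; host item stmt-ResolutionOfSingularities-16155, helper). Nothing here proves resolution of
singularities in dimension ≥ 4 / characteristic `p`. NO theorem content: ABBREVIATING DEFINITIONS (predicates with explicit parameters, no
axioms, no cited fact) for the v4 chain designed in `res-dim4-typ-3/S3c-V4-ATLAS-MEMBERS-DESIGN.md` §6–7 (its theorems A1–A6 are the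
successor's; the format is fixed here so that typ-2's chart facts and typ-3's stage meet BY SIGNATURE). A member of the forest is now read through a finite ATLAS of zigzag charts
(«readings» `(s, T, X, D)`: state, centre, DEFERRAL SET `X ⊆ Fin 4 × K` — the reading OWNS the points of `V(z, x_T)` with `x_i = v`
for all `(i, v) ∈ X` —, and BUNDLE DIRECTIONS `D` every entry must contain). A child entry `(j, b, S″)` of a reading with `T ⊄ S″` is a
LINEAR ESCAPING child (`j ∈ S″`, `b|_T = 0`): its closure `B × ℙ(L)` in the exceptional divisor is read on the main chart `j` and on one extra
chart per `l ∈ T ∖ S″`, with EXPLICIT states (`escState`, justified by `…AtlasReadingState` p711075) and ownership «first chart that sees the point».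

* `ownedSetZ`, `shiftDefer`, `escState`, `mainReading`, `extraReading`, `AEdge`, `IsEscaping`, `BlockA`, `MemberAtlasZ`, `MemberDataA`.

AI-produced formalisation, weaker than expert review. bears_on: LADDER-RESOLUTION:D157-DOOR2 (res-dim4-pi · S3 (c) v4 atlas members · defs).
-/

set_option linter.dupNamespace false -- D-0017: single-problem summit path `Summit.<S>.<S>.…` by design

noncomputable section

open MvPolynomial Finset CategoryTheory AlgebraicGeometry Opposite TopologicalSpace
open AlgebraicGeometry.Scheme.IdealSheafData (ofIdealTop vanishingIdeal)

namespace Summit.ResolutionOfSingularities.ResolutionOfSingularities.Theorems.PIDim4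

open Literature.AlgebraicGeometry.Resolution
open Literature.AlgebraicGeometry.Resolution.Hauser2010
open Literature.AlgebraicGeometry.Resolution.AffinePointBlowup (P A γ coord Wtop ξ)

namespace Equimultiple

section DefsA

variable {K : Type} [Field K] (p : ℕ) [DecidableEq K]

/-- A READING of an atlas member: state, centre, deferral set, bundle directions. [cite: BierstoneGrigorievMilmanWlodarczyk2011, Def. 3.1.3] -/
abbrev AReading (K : Type) [Field K] : Type := State K × Finset (Fin 4) × Finset (Fin 4 × K) × Finset (Fin 4)

omit [DecidableEq K] in
/-- **The owned coordinate subspace of a reading**: the points of `V(z, x_T) ⊆ 𝔸⁵` with `x_i = v` for every deferred pair `(i, v) ∈ X`.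
[cite: Hauser2010, §G (charts of a blow-up and their overlaps)] -/
def ownedSetZ (T : Finset (Fin 4)) (X : Finset (Fin 4 × K)) : Set (P 4 K) :=
  {x : P 4 K | x ∈ (AffineCoordBlowup.CΛ 4 K (insert 0 (Fin.succ '' (T : Set (Fin 4)))) : Set (P 4 K)) ∧
    ∀ iv ∈ X, (MvPolynomial.X iv.1.succ - C iv.2 : A 4 K) ∈ x.asIdeal}

/-- Deferred pairs after the re-centring `x ↦ x + b` of a child, keeping only indices outside the new centre `S″`. [folklore] -/
def shiftDefer (b : Fin 4 → K) (S'' : Finset (Fin 4)) (X : Finset (Fin 4 × K)) : Finset (Fin 4 × K) :=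
  (X.image fun iv => (iv.1, iv.2 - b iv.1)).filter fun iv => iv.1 ∉ S''

/-- An entry `(j, b, S″)` of a reading with centre `T` is ESCAPING when `T ⊄ S″`. [cite: BierstoneGrigorievMilmanWlodarczyk2011, §4 Step 2b] -/
def IsEscaping (T : Finset (Fin 4)) (e : Fin 4 × (Fin 4 → K) × Finset (Fin 4)) : Prop := ¬ T ⊆ e.2.2

/-- **The state of the extra reading on chart `x_l`** of a linear escaping child `(j, b, S″)` of a reading with state `s` and centre `T`:
chart transform on chart `l`, translation by `b` (`b|_T = 0`), cleaning; history fields reset. By `eq_deletePthPowers_of_isClean_pow_add`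
(p711075) this IS typ-2's reading `g^p + τ(chartTransform)`. [cite: HauserPerlega2019PRIMS, §2] -/
def escState (T : Finset (Fin 4)) (l : Fin 4) (b : Fin 4 → K) (s : State K) : State K :=
  ⟨Literature.AlgebraicGeometry.Resolution.Hauser2010.deletePthPowers p
      (PointBlowup.translate b (CentreBlowup.chartTransform p T l s.F)), 0, ∅⟩

/-- The MAIN child reading of an entry `e = (j, b, S″)` at the reading `r = (s, T, X, D)`: v3's child pair, the shifted deferral set, and the
bundle directions `T ∖ S″` (empty for a non-escaping entry). [cite: BierstoneGrigorievMilmanWlodarczyk2011, Def. 3.1.3] -/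
def mainReading (r : AReading K) (e : Fin 4 × (Fin 4 → K) × Finset (Fin 4)) : AReading K :=
  (CentreBlowup.step p r.2.1 e.1 e.2.1 r.1, e.2.2, shiftDefer e.2.1 e.2.2 r.2.2.1, r.2.1 \ e.2.2)

/-- The EXTRA reading on chart `l ∈ T ∖ S″` of an escaping entry `e = (j, b, S″)` at `r = (s, T, X, D)`: state `escState`, centre
`insert l (S″ ∖ {j})`, deferrals «invisible to chart `j` and to the earlier extra charts», bundle directions `(insert j (T ∖ S″)) ∖ {l}`.
[cite: BierstoneGrigorievMilmanWlodarczyk2011, §4 Step 2b] -/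
def extraReading (r : AReading K) (e : Fin 4 × (Fin 4 → K) × Finset (Fin 4)) (l : Fin 4) : AReading K :=
  (escState p r.2.1 l e.2.1 r.1, insert l (e.2.2.erase e.1),
    shiftDefer e.2.1 (insert l (e.2.2.erase e.1)) r.2.2.1 ∪
      (insert (e.1, (0 : K)) (((r.2.1 \ e.2.2).filter fun l' => l' < l).image fun l' => (l', (0 : K)))),
    (insert e.1 (r.2.1 \ e.2.2)).erase l)

/-- **Edges of the atlas forest**: from a reading to the main reading of each entry and to each extra reading of each escaping entry.
[cite: BierstoneGrigorievMilmanWlodarczyk2011, Def. 3.1.3] -/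
def AEdge (plan : AReading K → Finset (Fin 4 × (Fin 4 → K) × Finset (Fin 4))) (r' r : AReading K) : Prop :=
  ∃ e ∈ plan r, r' = mainReading p r e ∨ ∃ l ∈ r.2.1 \ e.2.2, r' = extraReading p r e l

/-- **The block of conditions AT a reading `r = (s, T, X, D)`** (model terms): (P1) admissible entries — `j ∈ T`, `b_j = 0`, `j ∈ S″`,
`D ⊆ S″` (FIBREWISE: bundle directions fixed), the entry point is OWNED (`b_i = v` for `(i,v) ∈ X`), equimultiple, child-permissible on the
main chart, and for an ESCAPING entry `b|_T = 0` and permissibility of every extra reading; (P2) separated entries: disjoint bases (differ at a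
common index off `T`), or v3's clauses for two non-escaping entries, or the non-escaping entry's fibre point misses the escaping entry's bundle
`ℙ(L)` (chart not a bundle direction, or a non-zero fibre coordinate off the bundle), or two escaping entries with disjoint bundle direction
sets `insert j (T ∖ S″)`; (P3) owned leaf point walks; (P5) THREE-WAY cover of the owned normalised
equimultiple pairs: an entry of the chart, the closure of an escaping entry of ANOTHER chart (`b′_i = 0` on `(S″ ∩ T) ∖ {j}`, `b′_i = b_i` on
`S″ ∖ T`), or a leaf. [cite: BierstoneGrigorievMilmanWlodarczyk2011, Def. 3.1.3; §4 Step 2b] [cite: Hauser2010, §§F–G] -/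
def BlockA (plan : AReading K → Finset (Fin 4 × (Fin 4 → K) × Finset (Fin 4)))
    (leaves : AReading K → Finset (Fin 4 × (Fin 4 → K))) (r : AReading K) : Prop :=
  -- (P1) admissible entries
  (∀ e ∈ plan r, e.1 ∈ r.2.1 ∧ e.2.1 e.1 = 0 ∧ e.1 ∈ e.2.2 ∧ r.2.2.2 ⊆ e.2.2 ∧ (∀ iv ∈ r.2.2.1, e.2.1 iv.1 = iv.2) ∧
      CentreBlowup.IsEquimultiplePoint p r.2.1 e.1 e.2.1 r.1 ∧
      IsPermissibleCentre p e.2.2 (CentreBlowup.step p r.2.1 e.1 e.2.1 r.1).F ∧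
      (IsEscaping r.2.1 e → (∀ i ∈ r.2.1, e.2.1 i = 0) ∧
        ∀ l ∈ r.2.1 \ e.2.2, IsPermissibleCentre p (insert l (e.2.2.erase e.1)) (escState p r.2.1 l e.2.1 r.1).F)) ∧
  -- (P2) separated entries
  (∀ e ∈ plan r, ∀ e' ∈ plan r, e ≠ e' →
      (∃ i ∈ e.2.2, i ∈ e'.2.2 ∧ i ∉ r.2.1 ∧ e.2.1 i ≠ e'.2.1 i) ∨
      (¬ IsEscaping r.2.1 e ∧ ¬ IsEscaping r.2.1 e' ∧
        ((e.1 = e'.1 ∧ ∃ i ∈ e.2.2, i ∈ e'.2.2 ∧ e.2.1 i ≠ e'.2.1 i) ∨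
         (e.1 ≠ e'.1 ∧ ((e'.2.1 e.1 = 0 ∧ e.1 ∈ e'.2.2) ∨ (e.2.1 e'.1 = 0 ∧ e'.1 ∈ e.2.2))))) ∨
      (IsEscaping r.2.1 e ∧ ¬ IsEscaping r.2.1 e' ∧
        (e'.1 ∉ insert e.1 (r.2.1 \ e.2.2) ∨ ∃ i ∈ r.2.1, e'.2.1 i ≠ 0 ∧ i ∉ insert e.1 (r.2.1 \ e.2.2))) ∨
      (IsEscaping r.2.1 e' ∧ ¬ IsEscaping r.2.1 e ∧
        (e.1 ∉ insert e'.1 (r.2.1 \ e'.2.2) ∨ ∃ i ∈ r.2.1, e.2.1 i ≠ 0 ∧ i ∉ insert e'.1 (r.2.1 \ e'.2.2))) ∨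
      (IsEscaping r.2.1 e ∧ IsEscaping r.2.1 e' ∧ Disjoint (insert e.1 (r.2.1 \ e.2.2)) (insert e'.1 (r.2.1 \ e'.2.2)))) ∧
  -- (P3) owned leaf point walks
  (∀ lf ∈ leaves r, (∀ iv ∈ r.2.2.1, lf.2 iv.1 = iv.2) ∧
      (CentreBlowup.IsEquimultiplePoint p r.2.1 lf.1 lf.2 r.1 →
        Acc (fun s' s : State K => Edge p Finset.univ s s') (CentreBlowup.step p r.2.1 lf.1 lf.2 r.1) ∧
        ∀ s' : State K, Relation.ReflTransGen (fun a e : State K => Edge p Finset.univ a e)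
            (CentreBlowup.step p r.2.1 lf.1 lf.2 r.1) s' →
          {jb : Fin 4 × (Fin 4 → K) | jb.2 jb.1 = 0 ∧ CentreBlowup.IsEquimultiplePoint p Finset.univ jb.1 jb.2 s'}.Finite)) ∧
  -- (P5) THREE-WAY cover of the owned normalised equimultiple pairs
  (∀ (j' : Fin 4) (b' : Fin 4 → K), j' ∈ r.2.1 → b' j' = 0 → (∀ k ∈ r.2.1, k < j' → b' k = 0) →
      (∀ iv ∈ r.2.2.1, b' iv.1 = iv.2) → CentreBlowup.IsEquimultiplePoint p r.2.1 j' b' r.1 →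
      (∃ e ∈ plan r, e.1 = j' ∧ ∀ i ∈ e.2.2, b' i = e.2.1 i) ∨
      (∃ e ∈ plan r, IsEscaping r.2.1 e ∧ e.1 ≠ j' ∧ j' ∉ e.2.2 ∧
        (∀ i ∈ e.2.2, i ∈ r.2.1 → i ≠ e.1 → b' i = 0) ∧ (∀ i ∈ e.2.2, i ∉ r.2.1 → b' i = e.2.1 i)) ∨
      (j', b') ∈ leaves r)

variable {X' : Scheme.{0}}

omit [DecidableEq K] in
/-- **Atlas clause of a member**: for every reading a zigzag chart `X′ ←φ— Y —ψ→ 𝔸⁵` reading `M′` as `(z^p + s.F)·𝒪` and `𝓘(c)` as `𝓘Λ T`,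
seeing `V(z, x_T)`, with the translated-hyperplane boundary dictionary of v3; the member is COVERED by the images of the readings' OWNED
subspaces, and these images are pairwise disjoint (every point of the member belongs to exactly one reading).
[cite: BierstoneGrigorievMilmanWlodarczyk2011, Def. 3.1.3 (2), (4)] [cite: Hauser2010, §G] -/
def MemberAtlasZ (M' : MarkedIdeal X') (c : Closeds X') (R : Finset (AReading K)) : Prop :=
  ∃ (Y : ↥R → Scheme.{0}) (φ : ∀ r : ↥R, Y r ⟶ X') (ψ : ∀ r : ↥R, Y r ⟶ P 4 K),
    (∀ r : ↥R, IsOpenImmersion (φ r) ∧ IsOpenImmersion (ψ r) ∧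
      M'.ideal.comap (φ r) = (hypSheaf p r.1.1.F).comap (ψ r) ∧
      (vanishingIdeal c).comap (φ r) = (AffineCoordBlowup.𝓘Λ 4 K (insert 0 (Fin.succ '' (r.1.2.1 : Set (Fin 4))))).comap (ψ r) ∧
      (AffineCoordBlowup.CΛ 4 K (insert 0 (Fin.succ '' (r.1.2.1 : Set (Fin 4)))) : Set (P 4 K)) ⊆ Set.range (ψ r) ∧
      ∃ (idx : X'.IdealSheafData → Fin 4) (cst_ : X'.IdealSheafData → K),
        (∀ D ∈ M'.boundary,
          ((D.support : Set X') ∩ φ r '' (ψ r ⁻¹'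
            (AffineCoordBlowup.CΛ 4 K (insert 0 (Fin.succ '' (r.1.2.1 : Set (Fin 4)))) : Set (P 4 K)))).Nonempty →
          D.comap (φ r) = (ofIdealTop (Ideal.span {(γ 4 K).symm (X (idx D).succ + C (cst_ D))})).comap (ψ r) ∧
            (idx D ∈ r.1.2.1 → cst_ D = 0)) ∧
        (∀ D₁ ∈ M'.boundary, ∀ D₂ ∈ M'.boundary,
          ((D₁.support : Set X') ∩ φ r '' (ψ r ⁻¹'
            (AffineCoordBlowup.CΛ 4 K (insert 0 (Fin.succ '' (r.1.2.1 : Set (Fin 4)))) : Set (P 4 K)))).Nonempty →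
          ((D₂.support : Set X') ∩ φ r '' (ψ r ⁻¹'
            (AffineCoordBlowup.CΛ 4 K (insert 0 (Fin.succ '' (r.1.2.1 : Set (Fin 4)))) : Set (P 4 K)))).Nonempty →
          idx D₁ = idx D₂ → D₁ = D₂)) ∧
    (c : Set X') ⊆ ⋃ r : ↥R, φ r '' (ψ r ⁻¹' ownedSetZ r.1.2.1 r.1.2.2.1) ∧
    ∀ r r' : ↥R, r ≠ r' →
      Disjoint (φ r '' (ψ r ⁻¹' ownedSetZ r.1.2.1 r.1.2.2.1)) (φ r' '' (ψ r' ⁻¹' ownedSetZ r'.1.2.1 r'.1.2.2.1))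

/-- **The full datum of an ATLAS MEMBER `c`** with reading set `R`: basics per reading (`s.F ≠ 0` clean, `T` permissible) · `c` regular and
snc with the boundary · `MemberAtlasZ` · `BlockA` at every reading reachable along `AEdge` from a reading in `R` · `Acc` of the flipped edge
relation at every reading of `R` · «every boundary component meeting `c` contains `c`» (the model-free invariant of v3-H, needed for the
escaping children's dictionaries). [cite: BierstoneGrigorievMilmanWlodarczyk2011, Def. 3.1.3] [cite: Hauser2010, §§F–G] -/
def MemberDataA [IsAlgClosed K] [CharP K p] [Fact p.Prime]
    (plan : AReading K → Finset (Fin 4 × (Fin 4 → K) × Finset (Fin 4)))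
    (leaves : AReading K → Finset (Fin 4 × (Fin 4 → K)))
    (M' : MarkedIdeal X') (c : Closeds X') (R : Finset (AReading K)) : Prop :=
  (∀ r ∈ R, r.1.F ≠ 0 ∧ Literature.Barriers.ResolutionOfSingularities.HauserPerlega.IsClean p r.1.F ∧ IsPermissibleCentre p r.2.1 r.1.F) ∧
  Scheme.IsRegular (vanishingIdeal c).subscheme ∧ HasSNCWith M'.boundary (vanishingIdeal c) ∧
  MemberAtlasZ p M' c R ∧
  (∀ r ∈ R, ∀ q : AReading K,
    Relation.ReflTransGen (fun a b : AReading K => AEdge p plan b a) r q → BlockA p plan leaves q) ∧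
  (∀ r ∈ R, Acc (fun q' q : AReading K => AEdge p plan q' q) r) ∧
  (∀ D ∈ M'.boundary, ((D.support : Set X') ∩ (c : Set X')).Nonempty → (c : Set X') ⊆ D.support)

end DefsA

end Equimultiple

end Summit.ResolutionOfSingularities.ResolutionOfSingularities.Theorems.PIDim4

end
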